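import Mathlib
import Summits.Ventures.PercRepro2.TypedBHKPendantRoot

/-!
# Typed BHK 1.4 (row 2′TB) when the OTHER root `a₂` is a pendant vertex
(blind cell PercRepro2, p5 g2, 2026-08-25; sub-claim S4, `proofs/P5-TB14.md` §1)

`TB14`'s inequality `N(Q ∩ A ∩ B, Q) ≤ N(Q ∩ B, Q ∩ A)` is symmetric under the relabelling
`(a₁, b) ↔ (a₂, o)` composed with the exchange of the two copies: `Q = {a₁ ↮ a₂}` is symmetric,
and `1_{b ∈ C(a₁)}`, `1_{o ∈ C(a₂)}` are the same indicator with the roles exchanged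
(`iL ends a₂ o` and `iH ends a₂ o` are definitionally equal). So `tb14_of_pendant_root` applied to
the relabelled instance gives the inequality when `a₂` has exactly one incident free edge:

  `tb14_of_pendant_root₂`.

Together: typed BHK 1.4 (single-vertex) is a THEOREM on every instance in which one of the two
roots is a pendant vertex with a free edge. Unconditional, standard axioms.
-/

namespace Summit.Ventures.PercRepro2

namespace TypedBHKHalf

open CovForm A3InactiveTyped

section Pendant2

variable {V : Type} {E : Type} [Fintype E] [DecidableEq E] {R : Type*} [Field R] [LinearOrder R]
  [IsStrictOrderedRing R]

omit [Fintype E] [DecidableEq E] [LinearOrder R] [IsStrictOrderedRing R] in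
/-- `1_Q` is symmetric in the two roots. -/
lemma iQ_comm (ends : E → Sym2 V) (a₁ a₂ : V) (ω : Config E) :
    (iQ ends a₂ a₁ ω : R) = iQ ends a₁ a₂ ω := by
  unfold iQ
  have h : ω ∈ avoidAll ends a₁ {a₂} ↔ ω ∈ avoidAll ends a₂ {a₁} := by
    simp only [mem_avoidAll, Finset.mem_singleton, forall_eq]
    exact ⟨fun h hc => h (conn_symm hc), fun h hc => h (conn_symm hc)⟩
  by_cases hω : ω ∈ avoidAll ends a₂ {a₁}
  · rw [Set.indicator_of_mem (h.2 hω), Set.indicator_of_mem hω]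
  · rw [Set.indicator_of_notMem (fun h' => hω (h.1 h')), Set.indicator_of_notMem hω]

omit [Fintype E] [DecidableEq E] [LinearOrder R] [IsStrictOrderedRing R] in
/-- The relabelled same-copy product is the same-copy product (the factors commute). -/
lemma sameBO_relabel (ends : E → Sym2 V) (a₁ a₂ b o : V) (y w : Config E) :
    (sameBO ends a₂ a₁ o b y w : R) = sameBO ends a₁ a₂ b o y w := by
  unfold sameBO iL iH
  rw [iQ_comm ends a₁ a₂ w, iQ_comm ends a₁ a₂ y]
  ring

omit [Fintype E] [DecidableEq E] [LinearOrder R] [IsStrictOrderedRing R] in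
/-- The relabelled cross-copy product is the cross-copy product with the copies exchanged. -/
lemma crossBO_relabel (ends : E → Sym2 V) (a₁ a₂ b o : V) (y w : Config E) :
    (crossBO ends a₂ a₁ o b y w : R) = crossBO ends a₁ a₂ b o w y := by
  unfold crossBO iL iH
  rw [iQ_comm ends a₁ a₂ w, iQ_comm ends a₁ a₂ y]
  ring

/-- **Typed BHK 1.4 when `a₂` is a pendant vertex** (THEOREM, unconditional): if `a₂` has exactly
one incident edge `f`, `f` is free, `o ≠ a₂` and `a₁ ≠ a₂`, then `TB14`'s inequality holds at the
profile `(F, z)`. -/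
theorem tb14_of_pendant_root₂ (ends : E → Sym2 V) (a₁ a₂ b o : V) (f : E)
    (hpend : ∀ e, a₂ ∈ ends e → e = f) (ha : a₁ ≠ a₂) (ho : o ≠ a₂) (F : Finset E)
    (hfF : f ∈ F) (z : Config E) :
    pairCount F z (sameBO ends a₁ a₂ b o : Config E → Config E → R) ≤
      pairCount F z (crossBO ends a₁ a₂ b o) := by
  have h := tb14_of_pendant_root (R := R) ends a₂ a₁ o b f hpend ha ho F hfF z
  have h1 : pairCount F z (sameBO ends a₂ a₁ o b : Config E → Config E → R) =
      pairCount F z (sameBO ends a₁ a₂ b o) := by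
    unfold pairCount
    refine Finset.sum_congr rfl fun y _ => ?_
    rw [sameBO_relabel]
  have h2 : pairCount F z (crossBO ends a₂ a₁ o b : Config E → Config E → R) =
      pairCount F z (crossBO ends a₁ a₂ b o) := by
    rw [pairCount_swap (Φ := crossBO ends a₁ a₂ b o)]
    unfold pairCount
    refine Finset.sum_congr rfl fun y _ => ?_
    rw [crossBO_relabel]
  rw [h1, h2] at h
  exact h

end Pendant2

end TypedBHKHalf

end Summit.Ventures.PercRepro2
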